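/-
Copyright (c) 2026 the pub-hodgecm-mathlib formalisation cell (harness21).  Prover seat hodgecm-mathlib-LH4-p08 (g4), Track A «(D-RAM) FOUR-FRAME», unit U2H, the census leaf
(ρ2b′-X) `stub_U2H_fixedPointCensus_typeTwo_unit0` — dealer LH4-plan (g12) WORD #16∕#21 hand T5a «TORIC LEVEL CENSUS, K-UNRAMIFIED» (payer LH4-p14 (g3); plan owner LH4-p12 (g4)
T5-FRAME v1 «a character sum over K♮»): the hermitian-norm TWIST `t(ω) = ρN∕N`, `N = ωΘω`, its depth subgroups, and the TRANSLATION that turns a side into a subgroup coset.  2026-09-04.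
-/
import Literature.NumberTheory.LocalFields.QuadraticOrderHermitianLevel   -- ★ p857226 (this seat: `hermGen_sub_map_eq`, `v_hermGen_sub_map_eq`, `map_div_self_mul_map`) → ★ F3 p857156 → ★ T4
import HarnessLib

/-!
# The twist `t(ω) = ρ(ωΘω)∕(ωΘω)` of the hermitian norm: the norm hom `ω ↦ ωΘω` on `Mˣ`, the DEPTH SUBGROUPS `B_r = {ω : |ω| = 1, |ωΘω − ρ(ωΘω)| ≤ r}` (they contain the
# order units of conductor `c` once `r ≥ |c(α − ρα)|`), and the TRANSLATION LEMMA: if `η·t(ω₀) = −1` then `{ω : |ω| = 1, |1 + η·t(ω)| ≤ r} = ω₀·B_r`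
(Serre, *Local Fields* Ch. V §1–§3; Jacobowitz 1962 §4; Flicker 1998 p. 84)

Topic `NumberTheory/LocalFields`; namespace `Literature.NumberTheory.LocalFields.QuadraticOrder` (★ T4 chain; ★ p857226).  THEOREMS ONLY (no definition, no instance, no notation, no named
fact, no `sorry`); kernel lane `--supports stmt-HodgeConjecture-24833` (count-neutral).  Cell `pub/hodgecm-mathlib` (D-0151), crux H413, Track A «(D-RAM) FOUR-FRAME», unit U2H: in the
toric census of (ρ2b′-X) the `ρ`-depth of the dual generator `y` of `x₀𝒪_j` is `|y|·|1 + η·t(x₀)|` (★ p857226 `v_hermGen_sub_map_eq`; `η = ρh∕h`), so the hyperbolic-side level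
sets are the fibres `{v(1 + ηt) = j − a}` and the census is a count of classes `ω𝒪_jˣ` by the depth of `ηt(ω)` (this seat's T5a sheet v3 (UNR±), (M3)–(M7)).  THIS FILE supplies the
group-theoretic skeleton of that count INSIDE the one field `M` (no third-field type yet): the norm `ω ↦ ωΘω` as the monoid hom `MonoidHom.id · Units.map Θ` on `Mˣ` (no definition),
its values are `Θ`-fixed and their twists `t = ρN∕N` have norm one; the depth sets `B_r` are SUBGROUPS (existence with membership) containing the order units; and the TRANSLATION
LEMMA — on the hyperbolic side an isotropic vector gives a unit `ω₀` with `η·t(ω₀) = −1`, and then `1 + η·t(ω) = 1 − t(ω₀⁻¹ω)`, so the side's depth-`≥ r` set is the coset `ω₀·B_r`,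
whose classes modulo the order units number `[B_r : 𝒪_jˣ]` (this seat's F1 `ncard_image_mk_smul_subgroup`).  The index VALUES (`[U_M : B_r]` = Mars' index on `K♮`, ★ p857227;
`[U_M : 𝒪_jˣ]` = Flicker's, ★ `UnramifiedQuadraticOrderUnitIndex`) are transported in the sequel.
* §1 the norm hom and the twist: `coe_normHom`, `theta_normHom`, `map_div_normHom_mul_map` (`t·ρt = 1`), `v_twist_sub_one` (`|t(ω) − 1| = |N − ρN|` on units),
  `normHom_sub_map_le` (`|N − ρN| ≤ |ω − ρω|` on units), `twist_eq_of_fixed_mul` (`t(e·ω) = t(ω)` for `ρe = e`).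
* §2 subgroups by membership: `exists_subgroup_thetaFixed_units`, `exists_subgroup_thetaFixed_depth`, **`exists_subgroup_normDepth`** (`B_r`), `orderUnits_le_normDepth`.
* §3 **`setOf_v_one_add_mul_twist_le_eq_smul`** (THE TRANSLATION LEMMA) and `exists_unit_twist_eq_of_isotropic` (hyperbolic ⇒ a UNIT translator, when `ϖE` is a `ρ`-fixed uniformiser).
HONEST LABEL: HC_CM is proved only modulo the 7 printed citations (2 remaining named inputs: hLiu418 = stmt-HodgeConjecture-24832, h413 = stmt-HodgeConjecture-24833) until rung 0
closes; unconditional algebra, count-neutral (skeleton of organ F4-U of the (ρ2b′-X) payer plan; no census value asserted).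

## References
* [Serre1979] J.-P. Serre, *Local Fields*, GTM 67 (1979): Ch. V §1, §3 (units, their filtration, norm-one elements of a quadratic extension).
* [Jacobowitz1962] R. Jacobowitz, *Hermitian forms over local fields*, Amer. J. Math. 84 (1962): §4 (hermitian lattices on a line, isotropy).
* [Flicker1998UnitaryFL] Y. Z. Flicker, *Elementary proof of the fundamental lemma for a unitary group*, Canad. J. Math. 50 (1998): p. 84 REMARK (Mars' orders and their unit indices).
-/

set_option autoImplicit false

open WithZero
open scoped Pointwise

namespace Literature.NumberTheory.LocalFields.QuadraticOrder

variable {K : Type*} [Field K]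

/-! ## §1 The norm hom `ω ↦ ωΘω` on `Mˣ` and the twist `t(ω) = ρN∕N` -/

section Algebra

variable {ρ Θ : K →+* K}

/-- The norm hom `MonoidHom.id · Units.map Θ` on `Mˣ` has values `ωΘω`. [cite: Jacobowitz1962, §4] -/
theorem coe_normHom (ω : Kˣ) : (((MonoidHom.id Kˣ * Units.map (Θ : K →* K)) ω : Kˣ) : K) = (ω : K) * Θ ω := by
  rw [MonoidHom.mul_apply, Units.val_mul, Units.coe_map, MonoidHom.id_apply, MonoidHom.coe_coe]

/-- The norm `ωΘω` is `Θ`-FIXED (`ΘΘ = id`): it lies in the third field `K♮ = M^Θ` (★ F3 `map_mul_map_self` with `Θ` for `ρ`). [cite: Jacobowitz1962, §4] -/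
theorem theta_normHom (hΘΘ : ∀ x, Θ (Θ x) = x) (ω : Kˣ) :
    Θ ((((MonoidHom.id Kˣ * Units.map (Θ : K →* K)) ω : Kˣ) : K)) = (((MonoidHom.id Kˣ * Units.map (Θ : K →* K)) ω : Kˣ) : K) := by
  rw [coe_normHom, map_mul, hΘΘ, mul_comm]

/-- `ρ(eΘe) = eΘe` for `ρ`-FIXED `e` (`Θρ = ρΘ`): norms of base elements are fixed by both involutions. [cite: Serre1979, Ch. V §1] -/
theorem map_mul_theta_of_fixed (hΘρ : ∀ x, Θ (ρ x) = ρ (Θ x)) {e : K} (he : ρ e = e) : ρ (e * Θ e) = e * Θ e := by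
  rw [map_mul, he, ← hΘρ, he]

/-- **THE TWIST IS BLIND TO `ρ`-FIXED RESCALING**: `t(e·ω) = t(ω)` where `t(x) = ρ(xΘx)∕(xΘx)` (`ρe = e`, `e ≠ 0`). [cite: Serre1979, Ch. V §1] -/
theorem twist_eq_of_fixed_mul (hΘρ : ∀ x, Θ (ρ x) = ρ (Θ x)) {e : K} (he : ρ e = e) (he0 : e ≠ 0) (x : K) :
    ρ (e * x * Θ (e * x)) / (e * x * Θ (e * x)) = ρ (x * Θ x) / (x * Θ x) :=
  map_div_mul_theta_self_of_fixed hΘρ he he0 ((map_ne_zero Θ).2 he0) x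

/-- **`|t(ω) − 1| = |N − ρN|` for a unit-valued norm** (`N = ωΘω`, `|N| = 1`). [cite: Serre1979, Ch. V §3] -/
theorem v_twist_sub_one [Valued K ℤᵐ⁰] {N : K} (hN : Valued.v N = 1) : Valued.v (ρ N / N - 1) = Valued.v (N - ρ N) := by
  have hN0 : N ≠ 0 := fun h0 => by rw [h0, map_zero] at hN; exact zero_ne_one hN
  rw [div_sub_one hN0, map_div₀, hN, div_one, Valuation.map_sub_swap]

/-- **`|ωΘω − ρ(ωΘω)| ≤ |ω − ρω|` for a unit `ω`** (`Θρ = ρΘ`, both isometric): the order units of conductor `c` have norms of `ρ`-depth `≤ |c(α − ρα)|`. [cite: Serre1979, Ch. V §3] -/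
theorem v_norm_sub_map_le [Valued K ℤᵐ⁰] (hvρ : ∀ x, Valued.v (ρ x) = Valued.v x) (hΘρ : ∀ x, Θ (ρ x) = ρ (Θ x)) (hvΘ : ∀ x, Valued.v (Θ x) = Valued.v x)
    {ω : K} (hω : Valued.v ω = 1) :
    Valued.v (ω * Θ ω - ρ (ω * Θ ω)) ≤ Valued.v (ω - ρ ω) := by
  rw [map_mul, ← hΘρ, show ω * Θ ω - ρ ω * Θ (ρ ω) = (ω - ρ ω) * Θ ω + ρ ω * (Θ ω - Θ (ρ ω)) by ring]
  refine (Valuation.map_add _ _ _).trans (max_le ?_ ?_)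
  · rw [map_mul, hvΘ, hω, mul_one]
  · rw [map_mul, hvρ, hω, one_mul, ← map_sub, hvΘ]

end Algebra

/-! ## §2 Subgroups of `Mˣ` by membership: `Θ`-fixed units, their depth filtration, and the norm-depth subgroups `B_r` -/

section Subgroups

variable [Valued K ℤᵐ⁰] {ρ Θ : K →+* K}

/-- **THE `Θ`-FIXED UNITS** `Ũ = {z : Θz = z, |z| = 1}` form a subgroup of `Mˣ` (existence with membership). [cite: Serre1979, Ch. V §1] -/
theorem exists_subgroup_thetaFixed_units :
    ∃ U : Subgroup Kˣ, ∀ z : Kˣ, z ∈ U ↔ Θ (z : K) = z ∧ Valued.v (z : K) = 1 := by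
  refine ⟨{ carrier := {z : Kˣ | Θ (z : K) = z ∧ Valued.v (z : K) = 1}, mul_mem' := ?_, one_mem' := ?_, inv_mem' := ?_ }, fun z => Iff.rfl⟩
  · rintro z w ⟨hz, hz1⟩ ⟨hw, hw1⟩
    exact ⟨by rw [Units.val_mul, map_mul, hz, hw], by rw [Units.val_mul, map_mul, hz1, hw1, mul_one]⟩
  · exact ⟨by rw [Units.val_one, map_one], by rw [Units.val_one, map_one]⟩
  · rintro z ⟨hz, hz1⟩
    exact ⟨by rw [Units.val_inv_eq_inv_val, map_inv₀, hz], by rw [Units.val_inv_eq_inv_val, map_inv₀, hz1, inv_one]⟩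

/-- Depth is submultiplicative on units: `|zw − ρ(zw)| ≤ max(|z − ρz|, |w − ρw|)` for `|z| = |w| = 1` (`ρ` isometric). [cite: Serre1979, Ch. V §1] -/
theorem v_mul_sub_map_mul_le (hvρ : ∀ x, Valued.v (ρ x) = Valued.v x) {z w : K} (hz : Valued.v z = 1) (hw : Valued.v w = 1) :
    Valued.v (z * w - ρ (z * w)) ≤ max (Valued.v (z - ρ z)) (Valued.v (w - ρ w)) := by
  rw [map_mul, show z * w - ρ z * ρ w = (z - ρ z) * w + ρ z * (w - ρ w) by ring]
  refine (Valuation.map_add _ _ _).trans (max_le_max ?_ ?_)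
  · rw [map_mul, hw, mul_one]
  · rw [map_mul, hvρ, hz, one_mul]

/-- Depth of an inverse: `|z⁻¹ − ρz⁻¹| = |z − ρz|` for `|z| = 1`. [cite: Serre1979, Ch. V §1] -/
theorem v_inv_sub_map_inv (hvρ : ∀ x, Valued.v (ρ x) = Valued.v x) {z : K} (hz : Valued.v z = 1) :
    Valued.v (z⁻¹ - ρ z⁻¹) = Valued.v (z - ρ z) := by
  have hz0 : z ≠ 0 := fun h0 => by rw [h0, map_zero] at hz; exact zero_ne_one hz
  have hρz0 : ρ z ≠ 0 := (map_ne_zero ρ).2 hz0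
  have : z⁻¹ - ρ z⁻¹ = -((z - ρ z) / (z * ρ z)) := by rw [map_inv₀]; field_simp; ring
  rw [this, Valuation.map_neg, map_div₀, map_mul, hvρ, hz, one_mul, div_one]

/-- **THE DEPTH FILTRATION OF THE `Θ`-FIXED UNITS** `Ṽ_r = {z : Θz = z, |z| = 1, |z − ρz| ≤ r}` is a subgroup of `Mˣ` (`ρ` isometric). [cite: Serre1979, Ch. V §1] -/
theorem exists_subgroup_thetaFixed_depth (hvρ : ∀ x, Valued.v (ρ x) = Valued.v x) (r : ℤᵐ⁰) :
    ∃ V : Subgroup Kˣ, ∀ z : Kˣ, z ∈ V ↔ Θ (z : K) = z ∧ Valued.v (z : K) = 1 ∧ Valued.v ((z : K) - ρ z) ≤ r := by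
  refine ⟨{ carrier := {z : Kˣ | Θ (z : K) = z ∧ Valued.v (z : K) = 1 ∧ Valued.v ((z : K) - ρ z) ≤ r}, mul_mem' := ?_, one_mem' := ?_, inv_mem' := ?_ },
    fun z => Iff.rfl⟩
  · rintro z w ⟨hz, hz1, hzr⟩ ⟨hw, hw1, hwr⟩
    refine ⟨by rw [Units.val_mul, map_mul, hz, hw], by rw [Units.val_mul, map_mul, hz1, hw1, mul_one], ?_⟩
    rw [Units.val_mul]
    exact (v_mul_sub_map_mul_le hvρ hz1 hw1).trans (max_le hzr hwr)
  · refine ⟨by rw [Units.val_one, map_one], by rw [Units.val_one, map_one], ?_⟩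
    rw [Units.val_one, map_one, sub_self, map_zero]; exact zero_le
  · rintro z ⟨hz, hz1, hzr⟩
    refine ⟨by rw [Units.val_inv_eq_inv_val, map_inv₀, hz], by rw [Units.val_inv_eq_inv_val, map_inv₀, hz1, inv_one], ?_⟩
    rw [Units.val_inv_eq_inv_val, v_inv_sub_map_inv hvρ hz1]; exact hzr

/-- **THE NORM-DEPTH SUBGROUPS `B_r = {ω : |ω| = 1, |ωΘω − ρ(ωΘω)| ≤ r}`** of `Mˣ` (the preimage of `Ṽ_r` under the norm hom, cut to units): existence with membership.
[cite: Serre1979, Ch. V §3] -/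
theorem exists_subgroup_normDepth (hvρ : ∀ x, Valued.v (ρ x) = Valued.v x) (hvΘ : ∀ x, Valued.v (Θ x) = Valued.v x) (r : ℤᵐ⁰) :
    ∃ B : Subgroup Kˣ, ∀ ω : Kˣ, ω ∈ B ↔ Valued.v (ω : K) = 1 ∧ Valued.v ((ω : K) * Θ ω - ρ ((ω : K) * Θ ω)) ≤ r := by
  have hN1 : ∀ {ω : K}, Valued.v ω = 1 → Valued.v (ω * Θ ω) = 1 := fun hω => by rw [map_mul, hvΘ, hω, mul_one]
  refine ⟨{ carrier := {ω : Kˣ | Valued.v (ω : K) = 1 ∧ Valued.v ((ω : K) * Θ ω - ρ ((ω : K) * Θ ω)) ≤ r}, mul_mem' := ?_, one_mem' := ?_, inv_mem' := ?_ },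
    fun ω => Iff.rfl⟩
  · rintro z w ⟨hz1, hzr⟩ ⟨hw1, hwr⟩
    refine ⟨by rw [Units.val_mul, map_mul, hz1, hw1, mul_one], ?_⟩
    rw [Units.val_mul, map_mul, show (z : K) * w * (Θ z * Θ w) = ((z : K) * Θ z) * ((w : K) * Θ w) by ring]
    exact (v_mul_sub_map_mul_le hvρ (hN1 hz1) (hN1 hw1)).trans (max_le hzr hwr)
  · refine ⟨by rw [Units.val_one, map_one], ?_⟩
    rw [Units.val_one, map_one, one_mul, map_one, sub_self, map_zero]; exact zero_le
  · rintro z ⟨hz1, hzr⟩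
    refine ⟨by rw [Units.val_inv_eq_inv_val, map_inv₀, hz1, inv_one], ?_⟩
    rw [Units.val_inv_eq_inv_val, map_inv₀, ← mul_inv, v_inv_sub_map_inv hvρ (hN1 hz1)]; exact hzr

/-- **THE ORDER UNITS LIE IN `B_r` ONCE `r ≥ |c(α − ρα)|`**: a unit of `ρ`-depth `≤ |c(α − ρα)|` has a norm of `ρ`-depth `≤ |c(α − ρα)|` (§1 `v_norm_sub_map_le`). [cite: Serre1979, Ch. V §3] -/
theorem orderUnits_le_normDepth (hvρ : ∀ x, Valued.v (ρ x) = Valued.v x) (hΘρ : ∀ x, Θ (ρ x) = ρ (Θ x)) (hvΘ : ∀ x, Valued.v (Θ x) = Valued.v x) {α c : K} {r : ℤᵐ⁰}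
    (hr : Valued.v (c * (α - ρ α)) ≤ r) {H B : Subgroup Kˣ}
    (hH : ∀ u : Kˣ, u ∈ H ↔ Valued.v (u : K) = 1 ∧ Valued.v ((u : K) - ρ u) ≤ Valued.v (c * (α - ρ α)))
    (hB : ∀ ω : Kˣ, ω ∈ B ↔ Valued.v (ω : K) = 1 ∧ Valued.v ((ω : K) * Θ ω - ρ ((ω : K) * Θ ω)) ≤ r) : H ≤ B := by
  intro u hu
  obtain ⟨hu1, hud⟩ := (hH u).1 hu
  exact (hB u).2 ⟨hu1, ((v_norm_sub_map_le hvρ hΘρ hvΘ hu1).trans hud).trans hr⟩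

/-! ## §3 The translation lemma: a side with an isotropic vector is a coset of `B_r` -/

/-- **THE TRANSLATION LEMMA.**  If `η·t(ω₀) = −1` for a unit `ω₀` (`t(x) = ρ(xΘx)∕(xΘx)`), then for every unit `ω`:
`|1 + η·t(ω)| = |N′ − ρN′|` with `N′ = (ω₀⁻¹ω)Θ(ω₀⁻¹ω)` — so **`{ω : |ω| = 1, |1 + η·t(ω)| ≤ r} = ω₀·B_r`** (pointwise, as subsets of `Mˣ`). [cite: Jacobowitz1962, §4] [cite: Serre1979, Ch. V §3] -/
theorem setOf_v_one_add_mul_twist_le_eq_smul (hvΘ : ∀ x, Valued.v (Θ x) = Valued.v x) {η : K} {ω₀ : Kˣ} (hω₀ : Valued.v (ω₀ : K) = 1)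
    (hη : η * (ρ ((ω₀ : K) * Θ ω₀) / ((ω₀ : K) * Θ ω₀)) = -1) (r : ℤᵐ⁰) {B : Subgroup Kˣ}
    (hB : ∀ ω : Kˣ, ω ∈ B ↔ Valued.v (ω : K) = 1 ∧ Valued.v ((ω : K) * Θ ω - ρ ((ω : K) * Θ ω)) ≤ r) :
    {ω : Kˣ | Valued.v (ω : K) = 1 ∧ Valued.v (1 + η * (ρ ((ω : K) * Θ ω) / ((ω : K) * Θ ω))) ≤ r} = ω₀ • (B : Set Kˣ) := by
  have hN1 : ∀ {ω : K}, Valued.v ω = 1 → Valued.v (ω * Θ ω) = 1 := fun hω => by rw [map_mul, hvΘ, hω, mul_one]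
  have hN0 : ∀ {ω : K}, Valued.v ω = 1 → ω * Θ ω ≠ 0 := fun hω h0 => by
    have := hN1 hω; rw [h0, map_zero] at this; exact zero_ne_one this
  have hN₀ : (ω₀ : K) * Θ ω₀ ≠ 0 := hN0 hω₀
  have hρN₀ : ρ ((ω₀ : K) * Θ ω₀) ≠ 0 := (map_ne_zero ρ).2 hN₀
  -- `η = −N₀∕ρN₀`
  have hηeq : η = -((ω₀ : K) * Θ ω₀ / ρ ((ω₀ : K) * Θ ω₀)) := by
    have := hη; field_simp at this ⊢; linear_combination this
  -- the key identity: `1 + η·t(ω) = −(ρN′∕N′ − 1)·…` precisely `|1 + η·t(ω)| = |N′ − ρN′|` with `N′ = N(ω)∕N(ω₀)`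
  have key : ∀ ω : Kˣ, Valued.v (ω : K) = 1 →
      Valued.v (1 + η * (ρ ((ω : K) * Θ ω) / ((ω : K) * Θ ω))) =
        Valued.v (((ω₀⁻¹ * ω : Kˣ) : K) * Θ ((ω₀⁻¹ * ω : Kˣ) : K) - ρ (((ω₀⁻¹ * ω : Kˣ) : K) * Θ ((ω₀⁻¹ * ω : Kˣ) : K))) := by
    intro ω hω
    have hN : (ω : K) * Θ ω ≠ 0 := hN0 hω
    have hcoe : ((ω₀⁻¹ * ω : Kˣ) : K) = (ω : K) / ω₀ := by rw [Units.val_mul, Units.val_inv_eq_inv_val, div_eq_mul_inv, mul_comm]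
    have hN' : ((ω : K) / ω₀) * Θ ((ω : K) / ω₀) = ((ω : K) * Θ ω) / ((ω₀ : K) * Θ ω₀) := by rw [map_div₀]; ring
    rw [hcoe, hN', map_div₀, hηeq]
    have : 1 + -((ω₀ : K) * Θ ω₀ / ρ ((ω₀ : K) * Θ ω₀)) * (ρ ((ω : K) * Θ ω) / ((ω : K) * Θ ω)) =
        -(((ω₀ : K) * Θ ω₀ / ((ω : K) * Θ ω)) *
          ((ρ ((ω : K) * Θ ω) / ρ ((ω₀ : K) * Θ ω₀)) - ((ω : K) * Θ ω) / ((ω₀ : K) * Θ ω₀))) := by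
      field_simp; ring
    rw [this, Valuation.map_neg, map_mul, map_div₀, hN1 hω₀, hN1 hω, div_one, one_mul, Valuation.map_sub_swap]
  ext ω
  rw [Set.mem_setOf_eq, Set.mem_smul_set]
  constructor
  · rintro ⟨hω, hr⟩
    refine ⟨ω₀⁻¹ * ω, (hB _).2 ⟨?_, ?_⟩, by rw [smul_eq_mul, mul_inv_cancel_left]⟩
    · rw [Units.val_mul, Units.val_inv_eq_inv_val, map_mul, map_inv₀, hω₀, hω, inv_one, one_mul]
    · rwa [← key ω hω]
  · rintro ⟨ω', hω', rfl⟩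
    obtain ⟨hω'1, hω'r⟩ := (hB ω').1 hω'
    have hω : Valued.v ((ω₀ • ω' : Kˣ) : K) = 1 := by rw [smul_eq_mul, Units.val_mul, map_mul, hω₀, hω'1, mul_one]
    refine ⟨hω, ?_⟩
    rw [key _ hω]
    have : ω₀⁻¹ * (ω₀ • ω') = ω' := by rw [smul_eq_mul, inv_mul_cancel_left]
    rw [this]
    exact hω'r

/-- **HYPERBOLIC ⇒ A UNIT TRANSLATOR** (frame where `ϖE` is a `ρ`-fixed uniformiser): an isotropic vector `x ≠ 0` (`h·Θx·x + ρ(h·Θx·x) = 0`, `h ≠ 0`) rescales by a power of `ϖE` to a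
UNIT `ω₀` with `(ρh∕h)·t(ω₀) = −1` (`t` is blind to the `ρ`-fixed factor, §1). [cite: Jacobowitz1962, §4] -/
theorem exists_unit_twist_eq_of_isotropic (hΘρ : ∀ x, Θ (ρ x) = ρ (Θ x))
    {ϖE : K} (hϖE : Valued.v ϖE = exp (-1 : ℤ)) (hρϖE : ρ ϖE = ϖE) {h : K} (hh : h ≠ 0)
    (hiso : ∃ x : K, x ≠ 0 ∧ h * Θ x * x + ρ (h * Θ x * x) = 0) :
    ∃ ω₀ : Kˣ, Valued.v (ω₀ : K) = 1 ∧ ρ h / h * (ρ ((ω₀ : K) * Θ ω₀) / ((ω₀ : K) * Θ ω₀)) = -1 := by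
  obtain ⟨x, hx0, hx⟩ := hiso
  have hϖ0 : ϖE ≠ 0 := fun h0 => by rw [h0, map_zero] at hϖE; exact (exp_ne_zero hϖE.symm).elim
  -- the valuation of `x` is a power of `|ϖE|`
  have hvx0 : Valued.v x ≠ 0 := (Valuation.ne_zero_iff _).2 hx0
  obtain ⟨n, hn⟩ : ∃ n : ℤ, Valued.v x = exp n := ⟨_, (exp_log hvx0).symm⟩
  set ω : K := x * ϖE ^ n with hω
  have hωv : Valued.v ω = 1 := by
    rw [hω, map_mul, map_zpow₀, hn, hϖE, ← exp_zsmul, smul_eq_mul, mul_neg, mul_one, ← exp_add, add_neg_cancel, exp_zero]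
  have hω0 : ω ≠ 0 := fun h0 => by rw [h0, map_zero] at hωv; exact zero_ne_one hωv
  refine ⟨Units.mk0 ω hω0, hωv, ?_⟩
  rw [Units.val_mk0]
  -- `t(ω) = t(x)` (the factor `ϖE^n` is `ρ`-fixed) and `h·N(x)·(1 + (ρh∕h)·t(x)) = h·Θx·x + ρ(h·Θx·x) = 0`
  have he : ρ (ϖE ^ n) = ϖE ^ n := by rw [map_zpow₀, hρϖE]
  have he0 : ϖE ^ n ≠ 0 := zpow_ne_zero n hϖ0
  have ht : ρ (ω * Θ ω) / (ω * Θ ω) = ρ (x * Θ x) / (x * Θ x) := by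
    rw [hω, show x * ϖE ^ n = ϖE ^ n * x by ring]
    exact twist_eq_of_fixed_mul hΘρ he he0 x
  rw [ht]
  have hN : x * Θ x ≠ 0 := mul_ne_zero hx0 ((map_ne_zero Θ).2 hx0)
  have hΘx : Θ x ≠ 0 := (map_ne_zero Θ).2 hx0
  have hx' : h * (x * Θ x) * (1 + ρ h / h * (ρ (x * Θ x) / (x * Θ x))) = 0 := by
    rw [← hx]
    simp only [map_mul]
    field_simp
  have h1 : 1 + ρ h / h * (ρ (x * Θ x) / (x * Θ x)) = 0 := by
    rcases mul_eq_zero.1 hx' with h' | h'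
    · exact absurd h' (mul_ne_zero hh hN)
    · exact h'
  linear_combination h1

end Subgroups

end Literature.NumberTheory.LocalFields.QuadraticOrder
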